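import Mathlib
import Summits.Ventures.PercRepro2.LocRows
import Summits.Ventures.PercRepro2.SwRow
import Summits.Ventures.PercRepro2.SwOut
import Summits.Ventures.PercRepro2.SwAllRow
import Summits.Ventures.PercRepro2.SwOutAll
import Summits.Ventures.PercRepro2.SwOutArmFlip
import Summits.Ventures.PercRepro2.SwOutArmThm
import Summits.Ventures.PercRepro2.SwOutCoreDefs
import Summits.Ventures.PercRepro2.SwOutCoreHull

/-!
# The core cube: colour symmetry and the clusters of `l` (blind cell PercRepro2, night-4 g13,
2026-08-26; proofs/NIGHT4-G12.md §3 (L1–L3), proofs/NIGHT4-G13.md §2)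

The DUAL base `dualBase ζ = flip (all arms) (blue ζ)` is again a core base with the same arms
(`CoreBase.dual`), and the blue colouring of a cube point is the dual realisation of the flipped
point (`blue_coreReal`); hence the blue cluster of `h` of a cube point is `redSet (flipAll ω)`
(`cluster_blue_coreReal`).  Going down the cube flips red arms to blue
(`coreReal_eq_flip_of_le`); since the red envelope `redAll` is red-closed and avoids `l`, the red
cluster of `l` only grows (`cluster_l_coreReal_anti`) and, by duality, the blue cluster of `l` only
shrinks (`cluster_blue_l_coreReal_mono`) — the monotonicity of the conditioning `Q` along the cube.
Every cube point stays in the outside class (`coreReal_mem_outClass`).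
-/

namespace Summit.Ventures.PercRepro2

namespace LocRows

open Hull

variable {V : Type*} {E : Type*}

open scoped Classical

variable {ends : E → Sym2 V}

/-- The red cluster of `l` grows when a set of vertices disjoint from it is flipped. -/
lemma cluster_l_subset_flip_of_disjoint {ζ' : Config E} {P : Set V} {l : V}
    (hP : ∀ x ∈ P, x ∉ cluster ends ζ' l) (hl : l ∉ P) :
    cluster ends ζ' l ⊆ cluster ends (flip ends P ζ') l := by
  intro v hv
  refine mem_of_conn_of_closed (ends := ends) (ω := ζ')
    (S := {x | x ∈ cluster ends ζ' l ∧ x ∉ P ∧ x ∈ cluster ends (flip ends P ζ') l}) ?_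
    ⟨mem_cluster_self _ _ _, hl, mem_cluster_self _ _ _⟩ hv |>.2.2
  intro a ha b hab
  obtain ⟨_, e, he, hends⟩ := openGraph_adj.1 hab
  have hbA : b ∈ cluster ends ζ' l := mem_cluster_of_edge ha.1 he hends
  have hbP : b ∉ P := fun hb => hP b hb hbA
  have hte : e ∉ touches ends P := by
    rintro ⟨x, hx, y, hxy⟩
    rw [hends, Sym2.eq_iff] at hxy
    rcases hxy with ⟨h1, _⟩ | ⟨_, h2⟩
    · exact ha.2.1 (h1 ▸ hx)
    · exact hbP (h2 ▸ hx)
  exact ⟨hbA, hbP, mem_cluster_of_edge ha.2.2 (by rw [flip_apply_of_notMem hte]; exact he) hends⟩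

/-- `flipAll` reverses the order. -/
lemma flipAll_le_flipAll {ι : Type*} {ω ω' : Config ι} (hω : ω ≤ ω') : flipAll ω' ≤ flipAll ω := by
  intro i
  have := hω i
  simp only [flipAll]
  cases h1 : ω i <;> cases h2 : ω' i <;> simp_all

section Dual

variable {ι : Type*} {A : ι → Set V} {pure : ι → Prop} {ζ : Config E} {h u : V} {H : Set V}
  (hb : CoreBase ends ζ h u H A pure)
include hb

/-- An edge with an end in `A i` touches a selection of arms iff `A i` is selected. -/
lemma CoreBase.mem_touches_sel_iff {p : ι → Prop} {i : ι} {e : E} {x y : V}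
    (hxy : ends e = s(x, y)) (hx : x ∈ A i) :
    e ∈ touches ends {z | ∃ j, p j ∧ z ∈ A j} ↔ p i := by
  constructor
  · rintro ⟨z, ⟨j, hj, hz⟩, w, hzw⟩
    rw [hxy, Sym2.eq_iff] at hzw
    rcases hzw with ⟨h1, _⟩ | ⟨_, h2⟩
    · rw [← h1] at hz
      have hji : j = i := by
        by_contra hne
        exact hb.arm_disj j i hne x hz hx
      rw [← hji]; exact hj
    · rw [← h2] at hz
      have hij : i = j := hb.arm_eq_of_edge hxy hx hz
      rw [hij]; exact hj
  · intro hi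
    exact ⟨x, ⟨i, hi, hx⟩, y, hxy⟩

/-- **Going down the cube flips red arms to blue**: `coreReal ω` is the flip, in `coreReal ω'`,
of the arms assigned `true` by `ω'` and `false` by `ω`. -/
theorem CoreBase.coreReal_eq_flip_of_le {ω ω' : Config ι} (hω : ω ≤ ω') :
    coreReal ends A ζ ω =
      flip ends {x | ∃ i, (ω i = false ∧ ω' i = true) ∧ x ∈ A i} (coreReal ends A ζ ω') := by
  funext e
  by_cases he : e ∈ touches ends (allArms A)
  · obtain ⟨i, x, y, hxy, hx⟩ := CoreBase.exists_arm_of_touches_allArms he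
    rw [hb.coreReal_apply_of_mem hxy hx]
    by_cases hD : e ∈ touches ends {x | ∃ i, (ω i = false ∧ ω' i = true) ∧ x ∈ A i}
    · have hD' := (hb.mem_touches_sel_iff (p := fun i => ω i = false ∧ ω' i = true) hxy hx).1 hD
      rw [flip_apply_of_mem hD, hb.coreReal_apply_of_mem hxy hx, if_pos hD'.2, if_neg]
      rw [hD'.1]; decide
    · have hD' := fun h' => hD ((hb.mem_touches_sel_iff
        (p := fun i => ω i = false ∧ ω' i = true) hxy hx).2 h')
      rw [flip_apply_of_notMem hD, hb.coreReal_apply_of_mem hxy hx]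
      have := hω i
      cases h1 : ω i
      · cases h2 : ω' i
        · simp
        · exact absurd ⟨h1, h2⟩ hD'
      · cases h2 : ω' i
        · rw [h1, h2] at this; exact absurd this (by simp)
        · simp
  · have hsub : {x | ∃ i, (ω i = false ∧ ω' i = true) ∧ x ∈ A i} ⊆ allArms A := by
      rintro x ⟨i, _, hx⟩; exact ⟨i, hx⟩
    rw [CoreBase.coreReal_apply_of_notMem he, flip_apply_of_notMem,
      CoreBase.coreReal_apply_of_notMem he]
    exact fun h' => he (touches_mono hsub h')

/-- **The red cluster of `l` grows going down the cube** (`l ∉ H`). -/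
theorem CoreBase.cluster_l_coreReal_anti {l : V} (hl : l ∉ H) {ω ω' : Config ι} (hω : ω ≤ ω') :
    cluster ends (coreReal ends A ζ ω') l ⊆ cluster ends (coreReal ends A ζ ω) l := by
  rw [hb.coreReal_eq_flip_of_le hω]
  refine cluster_l_subset_flip_of_disjoint ?_ ?_
  · rintro x ⟨i, ⟨_, hi'⟩, hx⟩ hxl
    have hxR : x ∈ redAll A h u ω' := by
      rw [mem_redAll_iff]; exact Or.inr (Or.inr ⟨i, hi', hx⟩)
    have hlR : l ∈ redAll A h u ω' :=
      mem_of_conn_of_closed (hb.redAll_closed ω') hxR (conn_symm hxl)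
    exact hl (hb.redAll_subset ω' hlR)
  · rintro ⟨i, _, hx⟩
    exact hl (hb.arm_sub i l hx).1

omit hb in
/-- The dual base: every arm blue, then everything touching an arm flipped back. -/
noncomputable def dualBase (ends : E → Sym2 V) (A : ι → Set V) (ζ : Config E) : Config E :=
  flip ends (allArms A) (blue ζ)

omit hb in
/-- The dual base on an edge touching an arm: the base colour. -/
lemma dualBase_apply_of_mem {e : E} (he : e ∈ touches ends (allArms A)) :
    dualBase ends A ζ e = ζ e := by
  simp only [dualBase, flip_apply_of_mem he, blue_apply, Bool.not_not]

omit hb in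
/-- The dual base on an edge touching no arm: the opposite colour. -/
lemma dualBase_apply_of_notMem {e : E} (he : e ∉ touches ends (allArms A)) :
    dualBase ends A ζ e = !ζ e := by
  simp only [dualBase, flip_apply_of_notMem he, blue_apply]

/-- An edge inside `A i ∪ {v}` (`v = h` or `v = u`) touches an arm. -/
lemma CoreBase.touches_allArms_of_within {i : ι} {v : V} (hv : v = h ∨ v = u) {e : E}
    (he : e ∈ within ends (A i ∪ {v})) : e ∈ touches ends (allArms A) := by
  obtain ⟨x, hx, y, hy, hxy⟩ := he
  rcases hx with hx | hx
  · exact ⟨x, ⟨i, hx⟩, y, hxy⟩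
  · rcases hy with hy | hy
    · exact ⟨y, ⟨i, hy⟩, x, ends_swap hxy⟩
    · exfalso
      rw [Set.mem_singleton_iff] at hx hy
      subst hx; subst hy
      rcases hv with rfl | rfl
      · exact hb.loop_h e hxy
      · exact hb.loop_u e hxy

/-- The inside colourings of the arms are the same for the dual base. -/
lemma CoreBase.insideConfig_dualBase {i : ι} {v : V} (hv : v = h ∨ v = u) :
    insideConfig ends (A i ∪ {v}) (dualBase ends A ζ) = insideConfig ends (A i ∪ {v}) ζ := by
  funext e
  simp only [insideConfig]
  by_cases he : e ∈ within ends (A i ∪ {v})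
  · rw [dualBase_apply_of_mem (hb.touches_allArms_of_within hv he)]
  · rw [decide_eq_false he]
    simp

/-- **The dual base is a core base** with the same arms. -/
theorem CoreBase.dual : CoreBase ends (dualBase ends A ζ) h u H A pure where
  hne := hb.hne
  bdry_blue := by
    intro e x y hxy hxH hyH
    by_cases he : e ∈ touches ends (allArms A)
    · rw [dualBase_apply_of_mem he]; exact hb.bdry_blue e x y hxy hxH hyH
    · exfalso
      -- `x` is in no arm, so `x = h` or `x = u`, whose edges all enter arms
      have hxA : ∀ i, x ∉ A i := fun i hx => he ⟨x, ⟨i, hx⟩, y, hxy⟩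
      by_cases hxh : x = h
      · subst hxh
        obtain ⟨j, hyj⟩ := hb.h_edges e y hxy
        exact hyH (hb.arm_sub j y hyj).1
      by_cases hxu : x = u
      · subst hxu
        obtain ⟨j, hyj⟩ := hb.u_edges e y hxy
        exact hyH (hb.arm_sub j y hyj).1
      obtain ⟨i, hxi⟩ := hb.arm_cover x hxH hxh hxu
      exact hxA i hxi
  arm_sub := hb.arm_sub
  arm_nonempty := hb.arm_nonempty
  arm_disj := hb.arm_disj
  arm_cover := hb.arm_cover
  no_cross := hb.no_cross
  h_edges := hb.h_edges
  h_red := by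
    intro e x hxe
    obtain ⟨j, hxj⟩ := hb.h_edges e x hxe
    rw [dualBase_apply_of_mem (CoreBase.touches_allArms_of_mem (ends_swap hxe) hxj)]
    exact hb.h_red e x hxe
  u_edges := hb.u_edges
  u_red := by
    intro e x hxe
    obtain ⟨j, hxj⟩ := hb.u_edges e x hxe
    rw [dualBase_apply_of_mem (CoreBase.touches_allArms_of_mem (ends_swap hxe) hxj)]
    exact hb.u_red e x hxe
  u_hadj := hb.u_hadj
  harm_conn := by
    intro i hpi x hx
    rw [hb.insideConfig_dualBase (Or.inl rfl)]
    exact hb.harm_conn i hpi x hx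
  pure_conn := by
    intro i hpi x hx
    rw [hb.insideConfig_dualBase (Or.inr rfl)]
    exact hb.pure_conn i hpi x hx
  pure_no_h := hb.pure_no_h

/-- **The blue colouring of a cube point is the dual realisation of the flipped point.** -/
theorem CoreBase.blue_coreReal (ω : Config ι) :
    blue (coreReal ends A ζ ω) = coreReal ends A (dualBase ends A ζ) (flipAll ω) := by
  funext e
  by_cases he : e ∈ touches ends (allArms A)
  · obtain ⟨i, x, y, hxy, hx⟩ := CoreBase.exists_arm_of_touches_allArms he
    rw [blue_apply, hb.coreReal_apply_of_mem hxy hx, hb.dual.coreReal_apply_of_mem hxy hx,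
      dualBase_apply_of_mem he]
    cases hωi : ω i <;> simp [flipAll, hωi]
  · rw [blue_apply, CoreBase.coreReal_apply_of_notMem he, CoreBase.coreReal_apply_of_notMem he,
      dualBase_apply_of_notMem he]

/-- **The blue cluster of `h` of a cube point**: `redSet` of the flipped point. -/
theorem CoreBase.cluster_blue_coreReal (ω : Config ι) :
    cluster ends (blue (coreReal ends A ζ ω)) h = redSet ends A h u pure (flipAll ω) := by
  rw [hb.blue_coreReal]
  exact hb.dual.cluster_coreReal (flipAll ω)

/-- **The blue cluster of `l` shrinks going down the cube** (`l ∉ H`). -/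
theorem CoreBase.cluster_blue_l_coreReal_mono {l : V} (hl : l ∉ H) {ω ω' : Config ι}
    (hω : ω ≤ ω') :
    cluster ends (blue (coreReal ends A ζ ω)) l ⊆ cluster ends (blue (coreReal ends A ζ ω')) l := by
  rw [hb.blue_coreReal, hb.blue_coreReal]
  exact hb.dual.cluster_l_coreReal_anti hl (flipAll_le_flipAll hω)

/-- The hull of `h` of every cube point lies in `H`. -/
theorem CoreBase.hull_coreReal_subset (ω : Config ι) : hull ends (coreReal ends A ζ ω) h ⊆ H := by
  intro x hx
  rcases hx with hx | hx
  · exact hb.cluster_coreReal_subset ω hx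
  · rw [hb.blue_coreReal] at hx
    exact hb.dual.cluster_coreReal_subset (flipAll ω) hx

/-- A realisation agrees with the base off the edges touching `H`. -/
lemma CoreBase.coreReal_apply_of_not_touches_H {ω : Config ι} {e : E}
    (he : e ∉ touches ends H) : coreReal ends A ζ ω e = ζ e := by
  apply CoreBase.coreReal_apply_of_notMem
  rintro ⟨x, ⟨i, hx⟩, y, hxy⟩
  exact he ⟨x, (hb.arm_sub i x hx).1, y, hxy⟩

/-- **Every cube point lies in the outside class** of the base (`H ⊆ U`). -/
theorem CoreBase.coreReal_mem_outClass [Fintype E] [DecidableEq E] {U : Set V} {ξ : Config E}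
    (hHU : H ⊆ U)
    (hζ : ζ ∈ outClass ends U h ξ) (ω : Config ι) :
    coreReal ends A ζ ω ∈ outClass ends U h ξ := by
  rw [mem_outClass] at hζ ⊢
  refine ⟨fun e he => ?_, (hb.hull_coreReal_subset ω).trans hHU⟩
  rw [hb.coreReal_apply_of_not_touches_H (fun h' => he (touches_mono hHU h'))]
  exact hζ.1 e he

end Dual

end LocRows

end Summit.Ventures.PercRepro2
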